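import Literature.NumberTheory.Sieve.PolymathGEHWindowDecomp
import HarnessLib

/-!
# Proposition 2.7 (`GEH ⟹ EH`): the window discrepancy of one Type II piece

Trunk AntSieve, tooling toward the named fact `Literature.NumberTheory.Sieve.weakDHL_three_two_of_GEH`
(D. H. J. Polymath, Res. Math. Sci. 1:12 (2014) = arXiv:1407.4897, Theorem 3.2(xii)).  For one pair of
pieces `γ = α_s ⋆ β_t` of the Type II term (file `PolymathGEHWindowDecomp`), the window discrepancy
`Δ_W(γ) = Δ(γ; N₁) − Δ(γ; N₀)` (`N₁ = ⌊X⌋`, `N₀ = ⌊X/2⌋`) is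

* zero, if the product range `((⌊ρ^s⌋+1)(m_t+1) − 1, ⌊ρ^{s+1}⌋⌊ρ^{t+1}⌋]` of the piece misses the window
  (`windowDisc_eq_zero_of_high`, `windowDisc_eq_zero_of_low`);
* the plain discrepancy `Δ(γ; N')` at any cut-off `N'` beyond the range, if the range lies inside the
  window (`windowDisc_eq_of_inside`) — this is the quantity `GEH` controls;
* at most `2 Δ(|α_s| ⋆ β_t; N') + (4/φ(q)) ‖α_s‖₁ ‖β_t‖₁` otherwise (`abs_windowDisc_le_of_straddle`) —
  the nonnegative majorant is again a `GEH` pair, and the `ℓ¹` term is summed over the few straddling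
  pairs in the sequel.

## References

* [Polymath8b2014] D. H. J. Polymath, Res. Math. Sci. 1 (2014), Art. 12 = arXiv:1407.4897,
  Proposition 2.7 (p. 7).
-/

noncomputable section

open Finset Real
open scoped ArithmeticFunction.Moebius ArithmeticFunction.vonMangoldt ArithmeticFunction.sigma

namespace Literature.NumberTheory.Sieve

open BFI (absAF absAF_apply)

namespace GEHtoEH

/-- The lower scale of the `β`-piece: `m_t = max(V, ⌊ρ^t⌋)`. [folklore] -/
def mV (V : ℕ) (ρ : ℝ) (t : ℕ) : ℕ := max V (lo ρ t)

/-- The window discrepancy `Δ(γ; N₁) − Δ(γ; N₀)`. [folklore] -/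
def windowDisc (γ : ℕ → ℝ) (N₀ N₁ : ℕ) (q : ℕ) (a : (ZMod q)ˣ) : ℝ :=
  apDiscrepancy γ N₁ q a - apDiscrepancy γ N₀ q a

/-! ### Support of a product of pieces -/

/-- Support of the `α`-piece. [folklore] -/
theorem alphaPiece_eq_zero {U : ℕ} {ρ : ℝ} {s n : ℕ} (h : n ≤ lo ρ s ∨ lo ρ (s + 1) < n) :
    alphaPiece U ρ s n = 0 := by
  rw [alphaPiece_apply, if_neg]
  rintro ⟨h1, h2⟩
  rcases h with h | h <;> omega

/-- Support of the `β`-piece. [folklore] -/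
theorem betaPiece_eq_zero {V : ℕ} {ρ : ℝ} {t c : ℕ} (h : c ≤ mV V ρ t ∨ lo ρ (t + 1) < c) :
    betaPiece V ρ t c = 0 := by
  rw [betaPiece_apply, if_neg]
  rintro ⟨h1, h2⟩
  rw [mV] at h
  rcases h with h | h <;> omega

/-- **Support of a product of pieces**: if `f` vanishes off `(A, A']` and `g` off `(B, B']` then
`(f ⋆ g)(n) = 0` unless `(A+1)(B+1) ≤ n ≤ A' B'`. [folklore] -/
theorem mul_apply_eq_zero_of_support {f g : ArithmeticFunction ℝ} {A A' B B' : ℕ}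
    (hf : ∀ n, n ≤ A ∨ A' < n → f n = 0) (hg : ∀ n, n ≤ B ∨ B' < n → g n = 0) {n : ℕ}
    (hn : n < (A + 1) * (B + 1) ∨ A' * B' < n) : (f * g) n = 0 := by
  rw [ArithmeticFunction.mul_apply]
  refine Finset.sum_eq_zero fun p hp => ?_
  rw [Nat.mem_divisorsAntidiagonal] at hp
  obtain ⟨hpn, hn0⟩ := hp
  by_cases h1 : p.1 ≤ A ∨ A' < p.1
  · rw [hf _ h1, zero_mul]
  by_cases h2 : p.2 ≤ B ∨ B' < p.2
  · rw [hg _ h2, mul_zero]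
  exfalso
  rw [not_or, not_le, not_lt] at h1 h2
  rcases hn with hn | hn
  · have : (A + 1) * (B + 1) ≤ p.1 * p.2 := Nat.mul_le_mul (by omega) (by omega)
    omega
  · have : p.1 * p.2 ≤ A' * B' := Nat.mul_le_mul h1.2 h2.2
    omega

/-- Support of `α_s ⋆ β_t`. [folklore] -/
theorem pieceMul_eq_zero (U V : ℕ) (ρ : ℝ) (s t : ℕ) {n : ℕ}
    (hn : n < (lo ρ s + 1) * (mV V ρ t + 1) ∨ lo ρ (s + 1) * lo ρ (t + 1) < n) :
    (alphaPiece U ρ s * betaPiece V ρ t) n = 0 :=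
  mul_apply_eq_zero_of_support (fun _ h => alphaPiece_eq_zero h) (fun _ h => betaPiece_eq_zero h) hn

/-- Support of `|α_s| ⋆ β_t`. [folklore] -/
theorem absPieceMul_eq_zero (U V : ℕ) (ρ : ℝ) (s t : ℕ) {n : ℕ}
    (hn : n < (lo ρ s + 1) * (mV V ρ t + 1) ∨ lo ρ (s + 1) * lo ρ (t + 1) < n) :
    (absAF (alphaPiece U ρ s) * betaPiece V ρ t) n = 0 :=
  mul_apply_eq_zero_of_support (fun _ h => by rw [absAF_apply, alphaPiece_eq_zero h, abs_zero])
    (fun _ h => betaPiece_eq_zero h) hn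

/-! ### The three cases -/

/-- **High pieces vanish**: if the product range starts beyond `N₁` the window discrepancy is `0`.
[folklore] -/
theorem windowDisc_eq_zero_of_high (U V : ℕ) (ρ : ℝ) (s t : ℕ) {N₀ N₁ : ℕ} (h01 : N₀ ≤ N₁)
    (h : N₁ < (lo ρ s + 1) * (mV V ρ t + 1)) (q : ℕ) (a : (ZMod q)ˣ) :
    windowDisc (fun n => (alphaPiece U ρ s * betaPiece V ρ t) n) N₀ N₁ q a = 0 := by
  unfold windowDisc
  have hz : ∀ N, N ≤ N₁ → apDiscrepancy (fun n => (alphaPiece U ρ s * betaPiece V ρ t) n) N q a = 0 := by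
    intro N hN
    rw [apDiscrepancy_congr (γ₂ := fun _ => (0 : ℝ)) (fun n hn => ?_), apDiscrepancy_zero]
    rw [Finset.mem_Icc] at hn
    exact pieceMul_eq_zero U V ρ s t (Or.inl (by omega))
  rw [hz N₁ le_rfl, hz N₀ h01, sub_zero]

/-- **Low pieces vanish**: if the product range ends at or below `N₀` the window discrepancy is `0`.
[folklore] -/
theorem windowDisc_eq_zero_of_low (U V : ℕ) (ρ : ℝ) (s t : ℕ) {N₀ N₁ : ℕ} (h01 : N₀ ≤ N₁)
    (h : lo ρ (s + 1) * lo ρ (t + 1) ≤ N₀) (q : ℕ) (a : (ZMod q)ˣ) :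
    windowDisc (fun n => (alphaPiece U ρ s * betaPiece V ρ t) n) N₀ N₁ q a = 0 := by
  unfold windowDisc
  rw [apDiscrepancy_eq_of_support (N := N₀) (fun n hn => pieceMul_eq_zero U V ρ s t (Or.inr (by omega))) h01,
    sub_self]

/-- **Inside pieces**: if the product range lies inside the window `(N₀, N₁]`, the window discrepancy
is the plain discrepancy at any cut-off `N'` beyond the range. [folklore] -/
theorem windowDisc_eq_of_inside (U V : ℕ) (ρ : ℝ) (s t : ℕ) {N₀ N₁ N' : ℕ}
    (hlow : N₀ < (lo ρ s + 1) * (mV V ρ t + 1)) (hhigh : lo ρ (s + 1) * lo ρ (t + 1) ≤ N₁)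
    (hN' : lo ρ (s + 1) * lo ρ (t + 1) ≤ N') (q : ℕ) (a : (ZMod q)ˣ) :
    windowDisc (fun n => (alphaPiece U ρ s * betaPiece V ρ t) n) N₀ N₁ q a =
      apDiscrepancy (fun n => (alphaPiece U ρ s * betaPiece V ρ t) n) N' q a := by
  unfold windowDisc
  have hz : apDiscrepancy (fun n => (alphaPiece U ρ s * betaPiece V ρ t) n) N₀ q a = 0 := by
    rw [apDiscrepancy_congr (γ₂ := fun _ => (0 : ℝ)) (fun n hn => ?_), apDiscrepancy_zero]
    rw [Finset.mem_Icc] at hn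
    exact pieceMul_eq_zero U V ρ s t (Or.inl (by omega))
  have hsupp : ∀ n, lo ρ (s + 1) * lo ρ (t + 1) < n → (alphaPiece U ρ s * betaPiece V ρ t) n = 0 :=
    fun n hn => pieceMul_eq_zero U V ρ s t (Or.inr hn)
  rw [hz, sub_zero, apDiscrepancy_eq_of_support hsupp hhigh, apDiscrepancy_eq_of_support hsupp hN']

/-- One cut-off of a straddling piece: `|Δ(γ; N)| ≤ Δ(G; N') + (2/φ(q)) Σ_{n ≤ N'} G(n)` for
`G = |α_s| ⋆ β_t` and any `N'` beyond the product range. [folklore] -/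
theorem abs_apDiscrepancy_pieceMul_le (U V : ℕ) (ρ : ℝ) (s t : ℕ) (N : ℕ) {N' : ℕ}
    (hN' : lo ρ (s + 1) * lo ρ (t + 1) ≤ N') {q : ℕ} (hq : 1 ≤ q) (a : (ZMod q)ˣ) :
    |apDiscrepancy (fun n => (alphaPiece U ρ s * betaPiece V ρ t) n) N q a| ≤
      apDiscrepancy (fun n => (absAF (alphaPiece U ρ s) * betaPiece V ρ t) n) N' q a +
        2 / (Nat.totient q : ℝ) * ∑ n ∈ Icc 1 N', (absAF (alphaPiece U ρ s) * betaPiece V ρ t) n := by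
  set γ : ℕ → ℝ := fun n => (alphaPiece U ρ s * betaPiece V ρ t) n with hγ
  set γN : ℕ → ℝ := fun n => if n ≤ N then γ n else 0 with hγN
  -- `Δ(γ; N) = Δ(γ 1_{≤N}; N) = Δ(γ 1_{≤N}; min N top) = Δ(γ 1_{≤N}; N')`
  have h1 : apDiscrepancy γ N q a = apDiscrepancy γN N q a :=
    apDiscrepancy_congr (fun n hn => by
      rw [Finset.mem_Icc] at hn
      rw [hγN]; simp only; rw [if_pos hn.2]) q a
  have hsupp : ∀ n, min N (lo ρ (s + 1) * lo ρ (t + 1)) < n → γN n = 0 := by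
    intro n hn
    rw [hγN]
    simp only
    split_ifs with h
    · exact pieceMul_eq_zero U V ρ s t (Or.inr (by omega))
    · rfl
  have h2 : apDiscrepancy γN N q a = apDiscrepancy γN N' q a := by
    rw [apDiscrepancy_eq_of_support hsupp (min_le_left _ _),
      apDiscrepancy_eq_of_support hsupp ((min_le_right _ _).trans hN')]
  rw [h1, h2]
  refine abs_apDiscrepancy_le_of_abs_le (fun n => ?_) N' hq a
  rw [hγN]
  simp only
  split_ifs
  · exact abs_mul_apply_le_absAF_mul _ _ (betaPiece_nonneg V ρ t) n
  · rw [abs_zero]; exact absAF_mul_nonneg _ _ (betaPiece_nonneg V ρ t) n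

/-- **Straddling pieces**: `|Δ_W(α_s ⋆ β_t)| ≤ 2 Δ(|α_s| ⋆ β_t; N') + (4/φ(q)) Σ_{n ≤ N'} (|α_s| ⋆ β_t)(n)`
for any cut-off `N'` beyond the product range. [cite: Polymath8b2014, Proposition 2.7] -/
theorem abs_windowDisc_le_of_straddle (U V : ℕ) (ρ : ℝ) (s t : ℕ) (N₀ N₁ : ℕ) {N' : ℕ}
    (hN' : lo ρ (s + 1) * lo ρ (t + 1) ≤ N') {q : ℕ} (hq : 1 ≤ q) (a : (ZMod q)ˣ) :
    |windowDisc (fun n => (alphaPiece U ρ s * betaPiece V ρ t) n) N₀ N₁ q a| ≤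
      2 * apDiscrepancy (fun n => (absAF (alphaPiece U ρ s) * betaPiece V ρ t) n) N' q a +
        4 / (Nat.totient q : ℝ) * ∑ n ∈ Icc 1 N', (absAF (alphaPiece U ρ s) * betaPiece V ρ t) n := by
  unfold windowDisc
  have h1 := abs_apDiscrepancy_pieceMul_le U V ρ s t N₁ hN' hq a
  have h0 := abs_apDiscrepancy_pieceMul_le U V ρ s t N₀ hN' hq a
  have := abs_sub (apDiscrepancy (fun n => (alphaPiece U ρ s * betaPiece V ρ t) n) N₁ q a)
    (apDiscrepancy (fun n => (alphaPiece U ρ s * betaPiece V ρ t) n) N₀ q a)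
  have e : 4 / (Nat.totient q : ℝ) * ∑ n ∈ Icc 1 N', (absAF (alphaPiece U ρ s) * betaPiece V ρ t) n =
      2 * (2 / (Nat.totient q : ℝ) * ∑ n ∈ Icc 1 N', (absAF (alphaPiece U ρ s) * betaPiece V ρ t) n) := by
    ring
  rw [e]
  linarith

/-- The `ℓ¹` term: `Σ_{n ≤ N'} (|α_s| ⋆ β_t)(n) ≤ ‖α_s‖₁ ‖β_t‖₁` with
`‖α_s‖₁ = Σ_{m ∈ (⌊ρ^s⌋, ⌊ρ^{s+1}⌋]} |a(m)|`, `‖β_t‖₁ = Σ_{c ∈ (m_t, ⌊ρ^{t+1}⌋]} Λ(c)`. [folklore] -/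
theorem sum_absPieceMul_le (U V : ℕ) (ρ : ℝ) (s t N' : ℕ) :
    ∑ n ∈ Icc 1 N', (absAF (alphaPiece U ρ s) * betaPiece V ρ t) n ≤
      (∑ m ∈ Ioc (lo ρ s) (lo ρ (s + 1)), |aFun U m|) * ∑ c ∈ Ioc (mV V ρ t) (lo ρ (t + 1)), (Λ c : ℝ) := by
  refine (sum_Icc_mul_le _ _ (fun n => abs_nonneg _) (betaPiece_nonneg V ρ t) N').trans ?_
  have h1 : ∑ m ∈ Icc 1 N', absAF (alphaPiece U ρ s) m ≤ ∑ m ∈ Ioc (lo ρ s) (lo ρ (s + 1)), |aFun U m| := by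
    -- drop the terms outside the piece, then compare on the intersection
    have e : ∀ m, absAF (alphaPiece U ρ s) m =
        if m ∈ Ioc (lo ρ s) (lo ρ (s + 1)) then |aFun U m| else 0 := by
      intro m
      rw [absAF_apply, alphaPiece_apply]
      by_cases hm : lo ρ s < m ∧ m ≤ lo ρ (s + 1)
      · rw [if_pos hm, if_pos (Finset.mem_Ioc.2 hm)]
      · rw [if_neg hm, if_neg (fun h => hm (Finset.mem_Ioc.1 h)), abs_zero]
    simp only [e]
    rw [← Finset.sum_filter]
    refine Finset.sum_le_sum_of_subset_of_nonneg (fun m hm => (Finset.mem_filter.1 hm).2) ?_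
    exact fun _ _ _ => abs_nonneg _
  have h2 : ∑ c ∈ Icc 1 N', betaPiece V ρ t c ≤ ∑ c ∈ Ioc (mV V ρ t) (lo ρ (t + 1)), (Λ c : ℝ) := by
    have e : ∀ c, betaPiece V ρ t c = if c ∈ Ioc (mV V ρ t) (lo ρ (t + 1)) then (Λ c : ℝ) else 0 := by
      intro c
      rw [betaPiece_apply]
      by_cases hc : max V (lo ρ t) < c ∧ c ≤ lo ρ (t + 1)
      · rw [if_pos hc, if_pos (show c ∈ Ioc (mV V ρ t) (lo ρ (t + 1)) from Finset.mem_Ioc.2 hc)]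
      · rw [if_neg hc, if_neg (show c ∉ Ioc (mV V ρ t) (lo ρ (t + 1)) from fun h => hc (Finset.mem_Ioc.1 h))]
    simp only [e]
    rw [← Finset.sum_filter]
    refine Finset.sum_le_sum_of_subset_of_nonneg (fun c hc => (Finset.mem_filter.1 hc).2) ?_
    exact fun _ _ _ => ArithmeticFunction.vonMangoldt_nonneg
  exact mul_le_mul h1 h2 (Finset.sum_nonneg fun _ _ => betaPiece_nonneg V ρ t _)
    (Finset.sum_nonneg fun _ _ => abs_nonneg _)

end GEHtoEH

end Literature.NumberTheory.Sieve
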